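import Summits.HodgeConjecture.HodgeConjecture.Theorems.F0P6aEmbeddingTorsorPlaces   -- ★ GEN p847748: torsor `τ = τ_w ∘ g`, `ker (residue ∘ τR (τ_w ∘ g)) = 𝔭_{g⁻¹ w}`, dictionary, `signature_ne_zero_of_ker_eq`
import Literature.NumberTheory.NumberFields.IdealNormEquationSupportPin                -- ★ LA3-p03 p847749: `(n) = 𝔞 · c𝔞` prime by prime, the `w`-block pin
import HarnessLib

/-!
# The canonical Frobenius twist ideal `𝔞_can(m, τR, w)` and its number-field rows (crux hLiu418 `--supports`; L3 socket `stub_FROB`)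

Cell `hodgecm-mathlib` (D-0151), P6 «MOD programme», crux `stmt-HodgeConjecture-24832` (hLiu418), line L3 (`stub_FROB` of the D-line
`Cruxes/HLiu418/Lines/F0_P6a_DatumOfInputs.lean` ED. 1 :554), organ (TW-SHAPE) of LA3-plan՚s L-DEAL v1 (02:02:23Z) «THE CANONICAL FROBENIUS IDEAL AND ITS
NUMBER-FIELD ROWS» (LA3-p03).  THEOREMS ONLY (no definition, no instance, no notation, no named fact, no `sorry`).  HC_CM is proved only modulo the 7
printed citations (2 remaining named inputs hLiu418 24832, h413 24833) until rung 0 closes; nothing here is about HC.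

THE TOKEN (GEN memo `MEMO-FPIN-spineED4` §1 = A-p03 closer skeleton v3 `stub_FPIN` ∕ `stub_ROOF0 (_hpin)`, no new definition): the EMBEDDING PRODUCT
`𝔞_can(m, τR, w) := ∏ τ ∈ univ.filter (m τ ≠ 0 ∧ ker (residue ∘ τR τ) ≠ 𝔭_{c•w}), ker (residue ∘ τR τ)` (`= ∏_v 𝔭_v^{k_v}`, `k_v = #{τ ↦ v : m τ ≠ 0} − [v = c•w]`).
Hypotheses: `F ∕ ℚ` Galois, `hpair` (`m τ + m (τ ∘ c) = 2`), `hcount` (the spine՚s `m_count`), `hone` (GEN (B-1): `m = 1` only at embeddings inducing `w` or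
`c•w` — a hypothesis, never derived), `hw : c•w ≠ w`.  §1 costumes of `c̃ := c.restrictScalars ℚ`; §2 the INVERSE half-type
`Ψ̃(m) := {g | m (τ_w ∘ g⁻¹) ≠ 0 ∧ 𝔭_{g • w} ≠ 𝔭_{c • w}}` (the dictionary ★ p847748 turns the embedding product into `∏ g ∈ Ψ̃, 𝔭_{g•w}` because «`τ_w ∘ g` induces
`g⁻¹ • w`»): `Stab(w) ⊆ Ψ̃`, `g ∈ Ψ̃ → c̃ g ∉ Ψ̃`, `g ∉ Ψ̃ → c̃ g ∈ Ψ̃`, (ρ0) `𝔞_can = ∏ g ∈ Ψ̃, 𝔭_{g • w}`; §3 the ROWS: (ρ∃) Frobenius shape (★ C2-arith p846565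
on `Ψ̃`), (ρ1) `𝔞_can ⊔ 𝔭_{c•w} = ⊤` (LA3-plan (π1)), (ρ2) `𝔭_w ∣ 𝔞_can`, (ρ3) `𝔞_can ≠ ⊥`, (ρ4) `(N𝔭_w, N) = 1 → 𝔞_can ⊔ (N) = ⊤`, (ρ5) the NORM EQUATION
`(N𝔭_w) = 𝔞_can · (c • 𝔞_can)` in the token shape of `RGDInputsAt.twistNorm_spec`, (ρ7) `ord_w 𝔞_can = ord_w (N𝔭_w)`, `ord_{c•w} 𝔞_can = 0` (★ p847749).
USE: `stub_ROOF0 (_hpin : I.twistIdeal γ = 𝔞_can(I.m, I.τR, w))` rewrites into this token; (ρ1)∕(ρ7) are the `c•w`∕`w`-block inputs of (rL); (ρ5) makes `twistNorm_frob`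
a corollary of F-PIN-can + `twistNorm_spec`; (ρ2)–(ρ4) are the `ModuliDatum` guards for Road B.
[cite: Shimura1998, §13.1 Thm. 1 (pp. 97–99) and (7)] [cite: CasselsFrohlichANT1967, Ch. VII §1.1 and Prop. 1.2 (ii)] [cite: RapoportSmithlingZhang2020Diagonal, §4.1 (4.6) p. 16]
-/

set_option autoImplicit false
set_option linter.dupNamespace false  -- `Summit.HodgeConjecture.HodgeConjecture.…` BY DESIGN (D-0017)

noncomputable section

open NumberField IsDedekindDomain IsLocalRing
open scoped Pointwise
open Literature.NumberTheory.GaloisRepresentations (closureValuationSubring)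
open Literature.NumberTheory.Automorphic
open Literature.AlgebraicGeometry.ComplexMultiplication.GaloisOcticStabiliser (GaloisOctic.complexConj_mul_comm GaloisOctic.complexConj_mul_self)
open Summit.HodgeConjecture.HodgeConjecture.Theorems.F0P6aKottwitzCountAtSplitPlace
open Summit.HodgeConjecture.HodgeConjecture.Theorems.F0P6aEmbeddingTorsorPlaces

namespace Summit.HodgeConjecture.HodgeConjecture.Theorems.F0P6aCanonicalFrobeniusIdealRows

variable {F : Type} [Field F] [NumberField F] [IsCMField F] (w : HeightOneSpectrum (𝓞 F))

/-! ### §1 Costumes of complex conjugation in `Gal(F∕ℚ)` -/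

/-- `c̃⁻¹ = c̃` for `c̃ := c.restrictScalars ℚ ∈ Gal(F∕ℚ)` (`c̃² = 1`, ★ `GaloisOctic.complexConj_mul_self`). [cite: Shimura1998, §18.2 Lemma (i)] -/
theorem restrictScalars_complexConj_inv :
    ((IsCMField.complexConj F).restrictScalars ℚ : F ≃ₐ[ℚ] F)⁻¹ = (IsCMField.complexConj F).restrictScalars ℚ :=
  inv_eq_of_mul_eq_one_right GaloisOctic.complexConj_mul_self

/-- `(c̃ g)⁻¹ = c̃ g⁻¹` (`c̃` is a central involution of `Gal(F∕ℚ)`, ★ `GaloisOctic.complexConj_mul_comm`). [cite: Shimura1998, §18.2 Lemma (i)] -/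
theorem complexConj_mul_inv [IsGalois ℚ F] (g : F ≃ₐ[ℚ] F) :
    ((IsCMField.complexConj F).restrictScalars ℚ * g)⁻¹ = (IsCMField.complexConj F).restrictScalars ℚ * g⁻¹ := by
  rw [mul_inv_rev, restrictScalars_complexConj_inv, GaloisOctic.complexConj_mul_comm g⁻¹]

/-- **The inverse costume**: `τ_w ∘ (c̃ g)⁻¹ = (τ_w ∘ g⁻¹) ∘ c` — the embedding attached to `(c̃ g)⁻¹` is the `c`-partner of the one attached to `g⁻¹`
(★ `structural_comp_algEquiv_comp_complexConj` at `g⁻¹`). [cite: Shimura1998, §18.2 Lemma (i)] -/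
theorem structural_comp_complexConj_mul_inv [IsGalois ℚ F] (g : F ≃ₐ[ℚ] F) :
    ((algebraMap (w.adicCompletion F) (AlgebraicClosure (w.adicCompletion F))).comp (algebraMap F (w.adicCompletion F))).comp
        ((((IsCMField.complexConj F).restrictScalars ℚ * g)⁻¹ : F ≃ₐ[ℚ] F) : F →+* F) =
      (((algebraMap (w.adicCompletion F) (AlgebraicClosure (w.adicCompletion F))).comp (algebraMap F (w.adicCompletion F))).comp
        ((g⁻¹ : F ≃ₐ[ℚ] F) : F →+* F)).comp ((IsCMField.complexConj F : F ≃ₐ[↥(maximalRealSubfield F)] F) : F →+* F) := by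
  rw [complexConj_mul_inv, structural_comp_algEquiv_comp_complexConj w g⁻¹]

/-- `(c̃ g) • w′ = c • (g • w′)` on places (★ `restrictScalars_complexConj_smul_eq`). [cite: Shimura1998, §13.1 Thm. 1 (pp. 97–99)] -/
theorem complexConj_mul_smul (g : F ≃ₐ[ℚ] F) (w' : HeightOneSpectrum (𝓞 F)) :
    ((IsCMField.complexConj F).restrictScalars ℚ * g) • w' = (IsCMField.complexConj F) • (g • w') := by
  rw [mul_smul, Literature.NumberTheory.ComplexMultiplication.restrictScalars_complexConj_smul_eq]

/-- `c • J = c̃ • J` on ideals of `𝓞 F` (both costumes act through the same ring automorphism). [cite: Shimura1998, §13.1 Thm. 1 (pp. 97–99)] -/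
theorem complexConj_smul_ideal_eq (J : Ideal (𝓞 F)) :
    (IsCMField.complexConj F) • J = ((IsCMField.complexConj F).restrictScalars ℚ : F ≃ₐ[ℚ] F) • J := by
  rw [Ideal.pointwise_smul_def, Ideal.pointwise_smul_def]
  congr 1

/-- `c • 𝔭_{g • w′} = 𝔭_{(c̃ g) • w′}` as ideals. [cite: Shimura1998, §13.1 Thm. 1 (pp. 97–99)] -/
theorem complexConj_smul_smul_asIdeal (g : F ≃ₐ[ℚ] F) (w' : HeightOneSpectrum (𝓞 F)) :
    (IsCMField.complexConj F) • (g • w').asIdeal = (((IsCMField.complexConj F).restrictScalars ℚ * g) • w').asIdeal := by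
  rw [complexConj_smul_ideal_eq, HeightOneSpectrum.smul_asIdeal, HeightOneSpectrum.smul_asIdeal, smul_smul]

section Signature

variable (τR : (F →+* AlgebraicClosure (w.adicCompletion F)) → (𝓞 F →+* ↥(closureValuationSubring (w.adicCompletion F))))
  (hτR : ∀ (τ : F →+* AlgebraicClosure (w.adicCompletion F)) (x : 𝓞 F),
    ((τR τ x : ↥(closureValuationSubring (w.adicCompletion F))) : AlgebraicClosure (w.adicCompletion F)) = τ (x : F))
  (m : (F →+* AlgebraicClosure (w.adicCompletion F)) → ℕ)
  (hpair : ∀ τ : F →+* AlgebraicClosure (w.adicCompletion F),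
    m τ + m (τ.comp ((IsCMField.complexConj F : F ≃ₐ[↥(maximalRealSubfield F)] F) : F →+* F)) = 2)
  (hcount : ∑ τ ∈ (Finset.univ.filter fun τ : F →+* AlgebraicClosure (w.adicCompletion F) =>
      RingHom.ker ((residue ↥(closureValuationSubring (w.adicCompletion F))).comp (τR τ)) =
        (((IsCMField.complexConj F) • w).asIdeal : Ideal (𝓞 F))), m τ = 1)
  (hone : ∀ τ : F →+* AlgebraicClosure (w.adicCompletion F), m τ = 1 →
      RingHom.ker ((residue ↥(closureValuationSubring (w.adicCompletion F))).comp (τR τ)) = w.asIdeal ∨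
        RingHom.ker ((residue ↥(closureValuationSubring (w.adicCompletion F))).comp (τR τ)) = ((IsCMField.complexConj F) • w).asIdeal)

/-! ### §2 The inverse half-type `Ψ̃(m) = {g | m (τ_w ∘ g⁻¹) ≠ 0 ∧ g • w ≠ c • w}` -/

/-- **The signatures of `τ_w ∘ (c̃ g)⁻¹` and `τ_w ∘ g⁻¹` are complementary** (`hpair` read through the inverse costume).
[cite: RapoportSmithlingZhang2020Diagonal, §4.1 (4.6) p. 16] -/
theorem signature_complexConj_mul_inv_add [IsGalois ℚ F]
    (hpair : ∀ τ : F →+* AlgebraicClosure (w.adicCompletion F),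
      m τ + m (τ.comp ((IsCMField.complexConj F : F ≃ₐ[↥(maximalRealSubfield F)] F) : F →+* F)) = 2)
    (g : F ≃ₐ[ℚ] F) :
    m (((algebraMap (w.adicCompletion F) (AlgebraicClosure (w.adicCompletion F))).comp (algebraMap F (w.adicCompletion F))).comp
          ((g⁻¹ : F ≃ₐ[ℚ] F) : F →+* F)) +
      m (((algebraMap (w.adicCompletion F) (AlgebraicClosure (w.adicCompletion F))).comp (algebraMap F (w.adicCompletion F))).comp
          ((((IsCMField.complexConj F).restrictScalars ℚ * g)⁻¹ : F ≃ₐ[ℚ] F) : F →+* F)) = 2 := by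
  rw [structural_comp_complexConj_mul_inv w g]
  exact hpair _

omit [IsCMField F] in
include hτR in
/-- **«`τ_w ∘ g⁻¹` induces `v`» ↔ `g • w = v`** (★ §2 at `g⁻¹`, `(g⁻¹)⁻¹ = g`). [cite: CasselsFrohlichANT1967, Ch. VII §1.1] -/
theorem ker_residue_restrict_structural_comp_inv_eq_iff (g : F ≃ₐ[ℚ] F) (v : HeightOneSpectrum (𝓞 F)) :
    RingHom.ker ((residue ↥(closureValuationSubring (w.adicCompletion F))).comp
        (τR (((algebraMap (w.adicCompletion F) (AlgebraicClosure (w.adicCompletion F))).comp (algebraMap F (w.adicCompletion F))).comp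
          ((g⁻¹ : F ≃ₐ[ℚ] F) : F →+* F)))) = v.asIdeal ↔ g • w = v := by
  rw [ker_residue_restrict_structural_comp_algEquiv_eq_iff w τR hτR g⁻¹ v, inv_inv]

include hτR hpair hcount in
/-- **`Stab(w) ⊆ Ψ̃(m)`** (the matching condition `hD` of ★ (C2-arith) for the inverse half-type): for `g • w = w`, `τ_w ∘ g⁻¹` induces `w`, so its signature is
non-zero (★ `signature_ne_zero_of_ker_eq`), and `g • w = w ≠ c • w`. [cite: Shimura1998, §13.1 Thm. 1 (pp. 97–99) and (7)] -/
theorem mem_invHalfType_of_smul_eq [IsGalois ℚ F] (hw : (IsCMField.complexConj F) • w ≠ w) (g : F ≃ₐ[ℚ] F) (hg : g • w = w) :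
    g ∈ Finset.univ.filter (fun g : F ≃ₐ[ℚ] F =>
      m (((algebraMap (w.adicCompletion F) (AlgebraicClosure (w.adicCompletion F))).comp (algebraMap F (w.adicCompletion F))).comp
          ((g⁻¹ : F ≃ₐ[ℚ] F) : F →+* F)) ≠ 0 ∧ (g • w).asIdeal ≠ ((IsCMField.complexConj F) • w).asIdeal) := by
  rw [Finset.mem_filter]
  refine ⟨Finset.mem_univ _, signature_ne_zero_of_ker_eq w τR hτR m hpair hcount _
    ((ker_residue_restrict_structural_comp_inv_eq_iff w τR hτR g w).2 hg), ?_⟩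
  rw [hg]
  exact fun h => hw (HeightOneSpectrum.ext h).symm

include hτR hpair hone in
/-- **`g ∈ Ψ̃(m) → c̃ g ∉ Ψ̃(m)`** (the half-type condition `hc` of ★ (C2-arith)): the embedding of `(c̃ g)⁻¹` is the `c`-partner of `τ_w ∘ g⁻¹`; if
`m (τ_w ∘ g⁻¹) = 2` the partner has `m = 0`; if `m (τ_w ∘ g⁻¹) = 1` then by `hone` it induces `w` (not `c•w`, as `g ∈ Ψ̃`), i.e. `g • w = w`, while `c̃ g ∈ Ψ̃` needs
`c • (g • w) ≠ c • w`. [cite: Shimura1998, §13.1 Thm. 1 (pp. 97–99) and (7)] -/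
theorem mul_not_mem_invHalfType [IsGalois ℚ F] (g : F ≃ₐ[ℚ] F)
    (hg : g ∈ Finset.univ.filter (fun g : F ≃ₐ[ℚ] F =>
      m (((algebraMap (w.adicCompletion F) (AlgebraicClosure (w.adicCompletion F))).comp (algebraMap F (w.adicCompletion F))).comp
          ((g⁻¹ : F ≃ₐ[ℚ] F) : F →+* F)) ≠ 0 ∧ (g • w).asIdeal ≠ ((IsCMField.complexConj F) • w).asIdeal)) :
    (IsCMField.complexConj F).restrictScalars ℚ * g ∉ Finset.univ.filter (fun g : F ≃ₐ[ℚ] F =>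
      m (((algebraMap (w.adicCompletion F) (AlgebraicClosure (w.adicCompletion F))).comp (algebraMap F (w.adicCompletion F))).comp
          ((g⁻¹ : F ≃ₐ[ℚ] F) : F →+* F)) ≠ 0 ∧ (g • w).asIdeal ≠ ((IsCMField.complexConj F) • w).asIdeal) := by
  intro hcg
  rw [Finset.mem_filter] at hg hcg
  obtain ⟨-, hm, hne⟩ := hg
  obtain ⟨-, hm', hne'⟩ := hcg
  have h2 := signature_complexConj_mul_inv_add w m hpair g
  rw [complexConj_mul_smul] at hne'
  rcases Nat.lt_or_ge (m (((algebraMap (w.adicCompletion F) (AlgebraicClosure (w.adicCompletion F))).comp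
      (algebraMap F (w.adicCompletion F))).comp ((g⁻¹ : F ≃ₐ[ℚ] F) : F →+* F))) 2 with hlt | hge
  · -- `m (τ_w ∘ g⁻¹) = 1`: it induces `w` or `c•w`, i.e. `g • w = w` or `g • w = c • w`
    have h1 : m (((algebraMap (w.adicCompletion F) (AlgebraicClosure (w.adicCompletion F))).comp
        (algebraMap F (w.adicCompletion F))).comp ((g⁻¹ : F ≃ₐ[ℚ] F) : F →+* F)) = 1 := by omega
    rcases hone _ h1 with hkw | hkcw
    · rw [ker_residue_restrict_structural_comp_inv_eq_iff w τR hτR g w] at hkw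
      exact hne' (by rw [hkw])
    · exact hne (by rw [(ker_residue_restrict_structural_comp_inv_eq_iff w τR hτR g _).1 hkcw])
  · -- `m (τ_w ∘ g⁻¹) = 2`: the partner has `m = 0`
    apply hm'
    omega

include hτR hpair hcount in
/-- **`g ∉ Ψ̃(m) → c̃ g ∈ Ψ̃(m)`** (so `Gal(F∕ℚ) = Ψ̃ ⊔ c̃Ψ̃`): if `m (τ_w ∘ g⁻¹) = 0` the partner has `m = 2 ≠ 0` and `g • w ≠ w` (an embedding inducing `w` has
`m ≠ 0`), so `c • (g • w) ≠ c • w`; if `g • w = c • w` then `(c̃ g) • w = w ≠ c • w` and the partner induces `w`, so `m ≠ 0`.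
[cite: Shimura1998, §13.1 Thm. 1 (pp. 97–99) and (7)] -/
theorem mul_mem_invHalfType_of_not_mem [IsGalois ℚ F] (hw : (IsCMField.complexConj F) • w ≠ w) (g : F ≃ₐ[ℚ] F)
    (hg : g ∉ Finset.univ.filter (fun g : F ≃ₐ[ℚ] F =>
      m (((algebraMap (w.adicCompletion F) (AlgebraicClosure (w.adicCompletion F))).comp (algebraMap F (w.adicCompletion F))).comp
          ((g⁻¹ : F ≃ₐ[ℚ] F) : F →+* F)) ≠ 0 ∧ (g • w).asIdeal ≠ ((IsCMField.complexConj F) • w).asIdeal)) :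
    (IsCMField.complexConj F).restrictScalars ℚ * g ∈ Finset.univ.filter (fun g : F ≃ₐ[ℚ] F =>
      m (((algebraMap (w.adicCompletion F) (AlgebraicClosure (w.adicCompletion F))).comp (algebraMap F (w.adicCompletion F))).comp
          ((g⁻¹ : F ≃ₐ[ℚ] F) : F →+* F)) ≠ 0 ∧ (g • w).asIdeal ≠ ((IsCMField.complexConj F) • w).asIdeal) := by
  rw [Finset.mem_filter] at hg
  push Not at hg
  replace hg := hg (Finset.mem_univ _)
  rw [Finset.mem_filter, complexConj_mul_smul]
  refine ⟨Finset.mem_univ _, ?_⟩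
  have h2 := signature_complexConj_mul_inv_add w m hpair g
  -- the two ways `g` can fail to be in `Ψ̃`
  by_cases h0 : m (((algebraMap (w.adicCompletion F) (AlgebraicClosure (w.adicCompletion F))).comp
      (algebraMap F (w.adicCompletion F))).comp ((g⁻¹ : F ≃ₐ[ℚ] F) : F →+* F)) = 0
  · -- `m (τ_w ∘ g⁻¹) = 0`
    refine ⟨by omega, fun h => ?_⟩
    have hgw : g • w = w := smul_left_cancel _ (HeightOneSpectrum.ext h)
    exact signature_ne_zero_of_ker_eq w τR hτR m hpair hcount _
      ((ker_residue_restrict_structural_comp_inv_eq_iff w τR hτR g w).2 hgw) h0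
  · -- `g • w = c • w`
    have hcw : g • w = (IsCMField.complexConj F) • w := HeightOneSpectrum.ext (hg h0)
    have hcgw : ((IsCMField.complexConj F).restrictScalars ℚ * g) • w = w := by
      rw [complexConj_mul_smul, hcw, Literature.NumberTheory.NumberFields.complexConj_smul_complexConj_smul]
    refine ⟨signature_ne_zero_of_ker_eq w τR hτR m hpair hcount _
      ((ker_residue_restrict_structural_comp_inv_eq_iff w τR hτR _ w).2 hcgw), ?_⟩
    rw [hcw, Literature.NumberTheory.NumberFields.complexConj_smul_complexConj_smul]
    exact fun h => hw (HeightOneSpectrum.ext h).symm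

include hτR in
/-- **(ρ0) THE EMBEDDING PRODUCT IS THE PLACE PRODUCT OVER THE INVERSE HALF-TYPE**: `𝔞_can(m, τR, w) = ∏ g ∈ Ψ̃(m), 𝔭_{g • w}` — reindex along the torsor
(★ `prod_filter_embeddings_eq`), read the induced place (★ `ker … (τ_w ∘ g) = 𝔭_{g⁻¹ • w}`), and invert `g ↦ g⁻¹`. [cite: CasselsFrohlichANT1967, Ch. VII §1.1] -/
theorem prod_filter_ker_eq_prod_invHalfType [IsGalois ℚ F] :
    (∏ τ ∈ Finset.univ.filter (fun τ : F →+* AlgebraicClosure (w.adicCompletion F) =>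
        m τ ≠ 0 ∧ RingHom.ker ((residue ↥(closureValuationSubring (w.adicCompletion F))).comp (τR τ)) ≠
          (((IsCMField.complexConj F) • w).asIdeal : Ideal (𝓞 F))),
      RingHom.ker ((residue ↥(closureValuationSubring (w.adicCompletion F))).comp (τR τ))) =
    ∏ g ∈ Finset.univ.filter (fun g : F ≃ₐ[ℚ] F =>
        m (((algebraMap (w.adicCompletion F) (AlgebraicClosure (w.adicCompletion F))).comp (algebraMap F (w.adicCompletion F))).comp
            ((g⁻¹ : F ≃ₐ[ℚ] F) : F →+* F)) ≠ 0 ∧ (g • w).asIdeal ≠ ((IsCMField.complexConj F) • w).asIdeal),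
      (g • w).asIdeal := by
  classical
  rw [prod_filter_embeddings_eq w]
  -- read the induced places, then invert
  refine Finset.prod_equiv (Equiv.inv (F ≃ₐ[ℚ] F)) (fun g => ?_) (fun g hg => ?_)
  · simp only [Finset.mem_filter, Finset.mem_univ, true_and, Equiv.inv_apply, inv_inv,
      ker_residue_restrict_structural_comp_algEquiv w τR hτR]
  · rw [Equiv.inv_apply, ker_residue_restrict_structural_comp_algEquiv w τR hτR g]

/-! ### §3 The rows of `𝔞_can(m, τR, w)` -/

include hτR hpair hcount hone in
/-- **(ρ∃) THE FROBENIUS SHAPE OF THE CANONICAL IDEAL**: `𝔞_can = 𝔭_w^d · 𝔟` with `𝔟 ⊥ 𝔭_w`, `𝔟 ⊥ 𝔭_{c•w}`, `𝔭_w^d ∥ (N𝔭_w)` and `N𝔭_w ∈ 𝔞_can` — ★ (C2-arith)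
`exists_frobeniusShape_prod_smul_asIdeal_complexConj` applied to the INVERSE half-type `Ψ̃(m)` (conditions `hD`, `hc` = §2), transported along (ρ0).
[cite: Shimura1998, §13.1 Thm. 1 (pp. 97–99) and (7)] -/
theorem exists_frobeniusShape_prod_filter_ker [IsGalois ℚ F] (hw : (IsCMField.complexConj F) • w ≠ w) :
    ∃ (𝔟 : Ideal (𝓞 F)) (d : ℕ),
      𝔟 ⊔ w.asIdeal = ⊤ ∧ 𝔟 ⊔ ((IsCMField.complexConj F) • w).asIdeal = ⊤ ∧
      (∏ τ ∈ Finset.univ.filter (fun τ : F →+* AlgebraicClosure (w.adicCompletion F) =>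
          m τ ≠ 0 ∧ RingHom.ker ((residue ↥(closureValuationSubring (w.adicCompletion F))).comp (τR τ)) ≠
            (((IsCMField.complexConj F) • w).asIdeal : Ideal (𝓞 F))),
        RingHom.ker ((residue ↥(closureValuationSubring (w.adicCompletion F))).comp (τR τ))) = w.asIdeal ^ d * 𝔟 ∧
      w.asIdeal ^ d ∣ Ideal.span {((Ideal.absNorm w.asIdeal : ℕ) : 𝓞 F)} ∧
      ¬ w.asIdeal ^ (d + 1) ∣ Ideal.span {((Ideal.absNorm w.asIdeal : ℕ) : 𝓞 F)} ∧
      ((Ideal.absNorm w.asIdeal : ℕ) : 𝓞 F) ∈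
        (∏ τ ∈ Finset.univ.filter (fun τ : F →+* AlgebraicClosure (w.adicCompletion F) =>
          m τ ≠ 0 ∧ RingHom.ker ((residue ↥(closureValuationSubring (w.adicCompletion F))).comp (τR τ)) ≠
            (((IsCMField.complexConj F) • w).asIdeal : Ideal (𝓞 F))),
        RingHom.ker ((residue ↥(closureValuationSubring (w.adicCompletion F))).comp (τR τ))) := by
  classical
  rw [prod_filter_ker_eq_prod_invHalfType w τR hτR m]
  exact Literature.NumberTheory.ComplexMultiplication.exists_frobeniusShape_prod_smul_asIdeal_complexConj _ w
    (fun g hg => mem_invHalfType_of_smul_eq w τR hτR m hpair hcount hw g hg)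
    (fun g hg => mul_not_mem_invHalfType w τR hτR m hpair hone g hg)

include hτR hpair hcount hone in
/-- **(ρ1) `𝔞_can ⊔ 𝔭_{c•w} = ⊤` — THE CANONICAL IDEAL AVOIDS THE CONJUGATE PLACE** (LA3-plan (π1); the `c•w`-block input of (rL): `𝔠` is a unit at `c•w`): from the
shape `𝔭_w^d·𝔟` with `𝔟 ⊥ 𝔭_{c•w}` and `𝔭_w ⊥ 𝔭_{c•w}` (distinct maximal ideals). [cite: Shimura1998, §13.1 Thm. 1 (pp. 97–99) and (7)] -/
theorem prod_filter_ker_sup_complexConj_smul_eq_top [IsGalois ℚ F] (hw : (IsCMField.complexConj F) • w ≠ w) :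
    (∏ τ ∈ Finset.univ.filter (fun τ : F →+* AlgebraicClosure (w.adicCompletion F) =>
        m τ ≠ 0 ∧ RingHom.ker ((residue ↥(closureValuationSubring (w.adicCompletion F))).comp (τR τ)) ≠
          (((IsCMField.complexConj F) • w).asIdeal : Ideal (𝓞 F))),
      RingHom.ker ((residue ↥(closureValuationSubring (w.adicCompletion F))).comp (τR τ))) ⊔
      ((IsCMField.complexConj F) • w).asIdeal = ⊤ := by
  obtain ⟨𝔟, d, -, h𝔟c, hprod, -, -, -⟩ := exists_frobeniusShape_prod_filter_ker w τR hτR m hpair hcount hone hw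
  rw [hprod]
  have hwc : w.asIdeal ⊔ ((IsCMField.complexConj F) • w).asIdeal = ⊤ :=
    Ideal.IsMaximal.coprime_of_ne w.isMaximal ((IsCMField.complexConj F) • w).isMaximal
      (fun h => hw (HeightOneSpectrum.ext h).symm)
  rw [Ideal.mul_sup_eq_of_coprime_left (Ideal.pow_sup_eq_top hwc)]
  exact h𝔟c

include hτR hpair hcount hone in
/-- The canonical ideal is NOT contained in `𝔭_{c•w}`. [cite: Shimura1998, §13.1 Thm. 1 (pp. 97–99) and (7)] -/
theorem not_prod_filter_ker_le_complexConj_smul [IsGalois ℚ F] (hw : (IsCMField.complexConj F) • w ≠ w) :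
    ¬ (∏ τ ∈ Finset.univ.filter (fun τ : F →+* AlgebraicClosure (w.adicCompletion F) =>
        m τ ≠ 0 ∧ RingHom.ker ((residue ↥(closureValuationSubring (w.adicCompletion F))).comp (τR τ)) ≠
          (((IsCMField.complexConj F) • w).asIdeal : Ideal (𝓞 F))),
      RingHom.ker ((residue ↥(closureValuationSubring (w.adicCompletion F))).comp (τR τ))) ≤
      ((IsCMField.complexConj F) • w).asIdeal := by
  intro hle
  have htop := prod_filter_ker_sup_complexConj_smul_eq_top w τR hτR m hpair hcount hone hw
  rw [sup_eq_right.2 hle] at htop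
  exact ((IsCMField.complexConj F) • w).isMaximal.ne_top htop

include hτR hpair hcount hone in
/-- **(ρ2) `𝔭_w ∣ 𝔞_can`** (the spine՚s `twistIdeal_frob` read on the canonical ideal): the exponent `d` of the shape is positive because `N𝔭_w ∈ 𝔭_w`.
[cite: Shimura1998, §13.1 Thm. 1 (pp. 97–99) and (7)] -/
theorem asIdeal_dvd_prod_filter_ker [IsGalois ℚ F] (hw : (IsCMField.complexConj F) • w ≠ w) :
    w.asIdeal ∣
      (∏ τ ∈ Finset.univ.filter (fun τ : F →+* AlgebraicClosure (w.adicCompletion F) =>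
        m τ ≠ 0 ∧ RingHom.ker ((residue ↥(closureValuationSubring (w.adicCompletion F))).comp (τR τ)) ≠
          (((IsCMField.complexConj F) • w).asIdeal : Ideal (𝓞 F))),
      RingHom.ker ((residue ↥(closureValuationSubring (w.adicCompletion F))).comp (τR τ))) := by
  obtain ⟨𝔟, d, -, -, hprod, -, hnd, -⟩ := exists_frobeniusShape_prod_filter_ker w τR hτR m hpair hcount hone hw
  rw [hprod]
  rcases Nat.eq_zero_or_pos d with rfl | hd
  · -- `d = 0` contradicts `¬ 𝔭_w ∣ (N𝔭_w)` since `N𝔭_w ∈ 𝔭_w`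
    exfalso
    apply hnd
    rw [zero_add, pow_one]
    exact Ideal.dvd_span_singleton.2 (Ideal.absNorm_mem w.asIdeal)
  · exact Dvd.dvd.mul_right (dvd_pow_self _ hd.ne') _

include hτR hpair hcount hone in
/-- **(ρ3) `𝔞_can ≠ 0`** (the spine՚s `twistIdeal_ne_bot` read on the canonical ideal): it contains `N𝔭_w ≠ 0`.
[cite: Shimura1998, §13.1 Thm. 1 (pp. 97–99) and (7)] -/
theorem prod_filter_ker_ne_bot [IsGalois ℚ F] (hw : (IsCMField.complexConj F) • w ≠ w) :
    (∏ τ ∈ Finset.univ.filter (fun τ : F →+* AlgebraicClosure (w.adicCompletion F) =>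
        m τ ≠ 0 ∧ RingHom.ker ((residue ↥(closureValuationSubring (w.adicCompletion F))).comp (τR τ)) ≠
          (((IsCMField.complexConj F) • w).asIdeal : Ideal (𝓞 F))),
      RingHom.ker ((residue ↥(closureValuationSubring (w.adicCompletion F))).comp (τR τ))) ≠ ⊥ := by
  obtain ⟨𝔟, d, -, -, -, -, -, hmem⟩ := exists_frobeniusShape_prod_filter_ker w τR hτR m hpair hcount hone hw
  intro h
  rw [h, Ideal.mem_bot, Nat.cast_eq_zero, Ideal.absNorm_eq_zero_iff] at hmem
  exact w.ne_bot hmem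

include hτR hpair hcount hone in
/-- **(ρ4) `𝔞_can ⊔ (N) = ⊤` WHEN `(N𝔭_w, N) = 1`** (the spine՚s `twistIdeal_coprime` read on the canonical ideal; «`p ∤ N`» is the letter guard that makes
`N𝔭_w = p^f` prime to `N`): `N𝔭_w ∈ 𝔞_can` and a Bézout relation. [cite: Shimura1998, §13.1 Thm. 1 (pp. 97–99) and (7)] -/
theorem prod_filter_ker_sup_span_eq_top [IsGalois ℚ F] (hw : (IsCMField.complexConj F) • w ≠ w) {N : ℕ}
    (hN : (Ideal.absNorm w.asIdeal).Coprime N) :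
    (∏ τ ∈ Finset.univ.filter (fun τ : F →+* AlgebraicClosure (w.adicCompletion F) =>
        m τ ≠ 0 ∧ RingHom.ker ((residue ↥(closureValuationSubring (w.adicCompletion F))).comp (τR τ)) ≠
          (((IsCMField.complexConj F) • w).asIdeal : Ideal (𝓞 F))),
      RingHom.ker ((residue ↥(closureValuationSubring (w.adicCompletion F))).comp (τR τ))) ⊔
      Ideal.span {((N : ℕ) : 𝓞 F)} = ⊤ := by
  obtain ⟨𝔟, d, -, -, -, -, -, hmem⟩ := exists_frobeniusShape_prod_filter_ker w τR hτR m hpair hcount hone hw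
  obtain ⟨a, b, hab⟩ := Nat.isCoprime_iff_coprime.2 hN
  rw [Ideal.eq_top_iff_one, Submodule.mem_sup]
  refine ⟨((a : ℤ) : 𝓞 F) * ((Ideal.absNorm w.asIdeal : ℕ) : 𝓞 F), Ideal.mul_mem_left _ _ hmem,
    ((b : ℤ) : 𝓞 F) * ((N : ℕ) : 𝓞 F), Ideal.mul_mem_left _ _ (Ideal.mem_span_singleton_self _), ?_⟩
  exact_mod_cast congrArg (Int.cast : ℤ → 𝓞 F) hab

include hτR hpair hcount hone in
/-- **(ρ5) THE NORM EQUATION OF THE CANONICAL IDEAL: `(N𝔭_w) = 𝔞_can · (c • 𝔞_can)`** in the token shape of the spine՚s `twistNorm_spec`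
(`Ideal.span {(n : 𝓞 F)} = 𝔞 * (IsCMField.complexConj F) • 𝔞`, `n = N𝔭_w = p^f`): `c • 𝔞_can = ∏_{g ∈ Ψ̃} 𝔭_{(c̃ g) • w}`, `Gal(F∕ℚ) = Ψ̃ ⊔ c̃ Ψ̃` (§2) and
`∏_{g ∈ Gal(F∕ℚ)} 𝔭_{g • w} = (N𝔭_w)` (★ `prod_univ_smul_asIdeal_eq_span_absNorm`).  Hence F-PIN-can makes `twistNorm_frob` (and `twistIdeal_frob`) corollaries of
`twistNorm_spec`. [cite: Shimura1998, §13.1 Thm. 1 (pp. 97–99) and (7)] [cite: NeukirchANT1999, Ch. III §1 (1.6) Prop. (iv)] -/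
theorem span_absNorm_eq_prod_filter_ker_mul_complexConj_smul [IsGalois ℚ F] (hw : (IsCMField.complexConj F) • w ≠ w) :
    Ideal.span {((Ideal.absNorm w.asIdeal : ℕ) : 𝓞 F)} =
      (∏ τ ∈ Finset.univ.filter (fun τ : F →+* AlgebraicClosure (w.adicCompletion F) =>
          m τ ≠ 0 ∧ RingHom.ker ((residue ↥(closureValuationSubring (w.adicCompletion F))).comp (τR τ)) ≠
            (((IsCMField.complexConj F) • w).asIdeal : Ideal (𝓞 F))),
        RingHom.ker ((residue ↥(closureValuationSubring (w.adicCompletion F))).comp (τR τ))) *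
      (IsCMField.complexConj F) •
        (∏ τ ∈ Finset.univ.filter (fun τ : F →+* AlgebraicClosure (w.adicCompletion F) =>
          m τ ≠ 0 ∧ RingHom.ker ((residue ↥(closureValuationSubring (w.adicCompletion F))).comp (τR τ)) ≠
            (((IsCMField.complexConj F) • w).asIdeal : Ideal (𝓞 F))),
        RingHom.ker ((residue ↥(closureValuationSubring (w.adicCompletion F))).comp (τR τ))) := by
  classical
  rw [prod_filter_ker_eq_prod_invHalfType w τR hτR m, Finset.smul_prod', ← Literature.NumberTheory.ComplexMultiplication.prod_univ_smul_asIdeal_eq_span_absNorm w]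
  simp_rw [complexConj_smul_smul_asIdeal]
  -- abbreviate the inverse half-type
  set Ψ : Finset (F ≃ₐ[ℚ] F) := Finset.univ.filter (fun g : F ≃ₐ[ℚ] F =>
      m (((algebraMap (w.adicCompletion F) (AlgebraicClosure (w.adicCompletion F))).comp (algebraMap F (w.adicCompletion F))).comp
          ((g⁻¹ : F ≃ₐ[ℚ] F) : F →+* F)) ≠ 0 ∧ (g • w).asIdeal ≠ ((IsCMField.complexConj F) • w).asIdeal) with hΨ
  -- `∏_{g ∈ Ψ} 𝔭_{(c̃ g) • w} = ∏_{h ∈ c̃Ψ} 𝔭_{h • w}`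
  have himg : ∏ g ∈ Ψ, ((((IsCMField.complexConj F).restrictScalars ℚ * g) • w).asIdeal : Ideal (𝓞 F)) =
      ∏ h ∈ Ψ.image (fun g => (IsCMField.complexConj F).restrictScalars ℚ * g), (h • w).asIdeal :=
    (Finset.prod_image (f := fun h : F ≃ₐ[ℚ] F => ((h • w).asIdeal : Ideal (𝓞 F))) (s := Ψ)
      (g := fun g : F ≃ₐ[ℚ] F => (IsCMField.complexConj F).restrictScalars ℚ * g) fun g _ g' _ h => mul_left_cancel h).symm
  rw [himg]
  -- `Ψ` and `c̃Ψ` are disjoint and cover `Gal(F∕ℚ)`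
  have hdisj : Disjoint Ψ (Ψ.image fun g => (IsCMField.complexConj F).restrictScalars ℚ * g) := by
    rw [Finset.disjoint_left]
    intro h hh hh'
    rw [Finset.mem_image] at hh'
    obtain ⟨g, hg, rfl⟩ := hh'
    exact mul_not_mem_invHalfType w τR hτR m hpair hone g hg hh
  have hcover : Ψ ∪ Ψ.image (fun g => (IsCMField.complexConj F).restrictScalars ℚ * g) = Finset.univ := by
    rw [Finset.eq_univ_iff_forall]
    intro g
    rw [Finset.mem_union]
    by_cases hg : g ∈ Ψ
    · exact Or.inl hg
    · refine Or.inr (Finset.mem_image.2 ⟨(IsCMField.complexConj F).restrictScalars ℚ * g,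
        mul_mem_invHalfType_of_not_mem w τR hτR m hpair hcount hw g hg, ?_⟩)
      rw [← mul_assoc, GaloisOctic.complexConj_mul_self, one_mul]
  rw [← Finset.prod_union hdisj, hcover]

include hτR hpair hcount hone in
/-- **(ρ7-w) THE `w`-EXPONENT OF THE CANONICAL IDEAL IS THE FULL EXPONENT OF `(N𝔭_w)`**: `ord_w 𝔞_can = ord_w (N𝔭_w)` (`= e_w f`; the `w`-block input of (rL):
`𝔠 = 𝔞_can 𝔭_w⁻¹` has `ord_w = e_w f − 1`) — ★ p847749՚s `w`-block pin applied to (ρ5) and (ρ1). [cite: Shimura1998, §13.1 Thm. 1 (pp. 97–99) and (7)] -/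
theorem count_prod_filter_ker_eq_count_span_absNorm [IsGalois ℚ F] (hw : (IsCMField.complexConj F) • w ≠ w) :
    (Associates.mk w.asIdeal).count (Associates.mk
      (∏ τ ∈ Finset.univ.filter (fun τ : F →+* AlgebraicClosure (w.adicCompletion F) =>
          m τ ≠ 0 ∧ RingHom.ker ((residue ↥(closureValuationSubring (w.adicCompletion F))).comp (τR τ)) ≠
            (((IsCMField.complexConj F) • w).asIdeal : Ideal (𝓞 F))),
        RingHom.ker ((residue ↥(closureValuationSubring (w.adicCompletion F))).comp (τR τ)))).factors =
    (Associates.mk w.asIdeal).count (Associates.mk (Ideal.span {((Ideal.absNorm w.asIdeal : ℕ) : 𝓞 F)})).factors :=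
  Literature.NumberTheory.NumberFields.count_eq_count_span_of_not_le_complexConj_smul
    (Ideal.absNorm_eq_zero_iff.not.2 w.ne_bot)
    (span_absNorm_eq_prod_filter_ker_mul_complexConj_smul w τR hτR m hpair hcount hone hw)
    (not_prod_filter_ker_le_complexConj_smul w τR hτR m hpair hcount hone hw)

include hτR hpair hcount hone in
/-- **(ρ7-c•w) `ord_{c•w} 𝔞_can = 0`** (★ p847749 `count_eq_zero_of_not_le` with (ρ1)). [cite: Shimura1998, §13.1 Thm. 1 (pp. 97–99) and (7)] -/
theorem count_complexConj_smul_prod_filter_ker_eq_zero [IsGalois ℚ F] (hw : (IsCMField.complexConj F) • w ≠ w) :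
    (Associates.mk ((IsCMField.complexConj F) • w).asIdeal).count (Associates.mk
      (∏ τ ∈ Finset.univ.filter (fun τ : F →+* AlgebraicClosure (w.adicCompletion F) =>
          m τ ≠ 0 ∧ RingHom.ker ((residue ↥(closureValuationSubring (w.adicCompletion F))).comp (τR τ)) ≠
            (((IsCMField.complexConj F) • w).asIdeal : Ideal (𝓞 F))),
        RingHom.ker ((residue ↥(closureValuationSubring (w.adicCompletion F))).comp (τR τ)))).factors = 0 :=
  Literature.NumberTheory.NumberFields.count_eq_zero_of_not_le (prod_filter_ker_ne_bot w τR hτR m hpair hcount hone hw)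
    (not_prod_filter_ker_le_complexConj_smul w τR hτR m hpair hcount hone hw)

end Signature

end Summit.HodgeConjecture.HodgeConjecture.Theorems.F0P6aCanonicalFrobeniusIdealRows

end
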